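import Literature.NumberTheory.Transcendental.PhilipponCriterionHomogenization
import HarnessLib

/-!
# Philippon's criterion over Nesterenko's toolkit, II: projective distance versus the affine polydisc — proofs only

`Literature/NumberTheory/Transcendental/PhilipponCriterionProjDist.lean` — proofs only (no new
definitions, nothing asserted). Second glue layer of the programme deriving
`Philippon1986_mainCriterion` (`PhilipponCriterion.lean`) from Nesterenko's toolkit (LNM 1752 Ch. 3
§4, `NesterenkoElimination.lean`).

Philippon's criterion measures closeness to `θ ∈ ℂⁿ` in the max-norm polydisc
`max_i |z_i − θ_i| ≤ e^{−R}` (Publ. Math. IHÉS 64 (1986), Thm 2.11 and Lemme 1.16, `‖y‖ = max |y_i/y_0|`),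
while Nesterenko's closest-point and distance statements (Prop. 4.13, Cor. 4.9–4.12) use the
projective distance `‖ω̄ − β̄‖ = max_{i<j} |ω_i β_j − ω_j β_i| · |ω̄|⁻¹ |β̄|⁻¹` (`Nesterenko.projDist`)
and `ρ(ω̄) = inf_{β ∈ V(𝔭)} ‖ω̄ − β̄‖` (`Nesterenko.rho`). At the point `ω̄ = (1, θ)` the two are
comparable (this file; `Θ = |ω̄| = max(1, max |θ_i|)`):

* `one_div_norm_le_projDist_of_apply_zero` — points at infinity (`β₀ = 0`) have
  `‖ω̄ − β̄‖ ≥ 1/Θ`;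
* `affine_near_of_projDist_le` — if `‖ω̄ − β̄‖ ≤ 1/(2Θ)` then `β₀ ≠ 0` and the affine point
  `z = (β₁/β₀, …, β_n/β₀)` satisfies `max |z_i − θ_i| ≤ 2Θ² ‖ω̄ − β̄‖`;
* `projDist_cons_one_le` — conversely `‖ω̄ − (1 : z)‖ ≤ 2 max |z_i − θ_i|`;
* `exists_mem_projZeros_projDist_lt` — `ρ(ω̄) < t` is witnessed by a zero (when `V ≠ ∅`);
* `smul_mem_projZeros`, `cons_one_div_mem_projZeros` — the zero set of an ideal containing the
  homogeneous components of its elements is a cone, so a zero `β̄` with `β₀ ≠ 0` may be normalised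
  to `(1 : z)`.

## References

* [Philippon1986Criteres] P. Philippon, Publ. Math. IHÉS 64 (1986), Lemme 1.16 (p. 24), §3 p. 41
  (`‖y‖ = max |y_i/y_0|`), proof of Lemme 2.14 p. 43 (passage between `Dist` and `‖x − θ‖`).
* [NesterenkoPhilippon2001] LNM 1752 (2001), Ch. 3 §4, the projective distance and (20) (p. 40).
-/

noncomputable section

open MvPolynomial Finset
open scoped NNReal
open Literature.NumberTheory.Transcendental.Nesterenko

namespace Literature.NumberTheory.Transcendental

namespace PhilipponMain

variable {m : ℕ}

/-! ### The numerator of the projective distance -/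

/-- Each `2 × 2` minor is bounded by the numerator `max_{i<j} |φ_i ψ_j − φ_j ψ_i|` of `‖φ̄ − ψ̄‖`.
[folklore] -/
theorem norm_minor_le_sup (φ ψ : Fin (m + 1) → ℂ) (p : SkewIdx m) :
    ‖φ p.1.1 * ψ p.1.2 - φ p.1.2 * ψ p.1.1‖ ≤
      ((Finset.univ.sup fun q : SkewIdx m => ‖φ q.1.1 * ψ q.1.2 - φ q.1.2 * ψ q.1.1‖₊ : ℝ≥0) : ℝ) := by
  have h := Finset.le_sup (f := fun q : SkewIdx m => ‖φ q.1.1 * ψ q.1.2 - φ q.1.2 * ψ q.1.1‖₊)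
    (Finset.mem_univ p)
  rw [← coe_nnnorm]
  exact_mod_cast h

/-- The numerator is bounded by any common bound `B ≥ 0` of the minors. [folklore] -/
theorem sup_minor_le (φ ψ : Fin (m + 1) → ℂ) {B : ℝ} (hB : 0 ≤ B)
    (h : ∀ p : SkewIdx m, ‖φ p.1.1 * ψ p.1.2 - φ p.1.2 * ψ p.1.1‖ ≤ B) :
    ((Finset.univ.sup fun q : SkewIdx m => ‖φ q.1.1 * ψ q.1.2 - φ q.1.2 * ψ q.1.1‖₊ : ℝ≥0) : ℝ)
      ≤ B := by
  have hs : (Finset.univ.sup fun q : SkewIdx m => ‖φ q.1.1 * ψ q.1.2 - φ q.1.2 * ψ q.1.1‖₊) ≤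
      B.toNNReal := Finset.sup_le fun q _ => by
    rw [← NNReal.coe_le_coe, coe_nnnorm, Real.coe_toNNReal _ hB]
    exact h q
  calc _ ≤ ((B.toNNReal : ℝ≥0) : ℝ) := by exact_mod_cast hs
    _ = B := Real.coe_toNNReal _ hB

/-- `‖φ̄ − ψ̄‖ · (|φ̄| |ψ̄|)` is the numerator, for non-zero `φ̄, ψ̄`. [folklore] -/
theorem projDist_mul_norm_mul_norm {φ ψ : Fin (m + 1) → ℂ} (hφ : φ ≠ 0) (hψ : ψ ≠ 0) :
    projDist φ ψ * (‖φ‖ * ‖ψ‖) =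
      ((Finset.univ.sup fun q : SkewIdx m => ‖φ q.1.1 * ψ q.1.2 - φ q.1.2 * ψ q.1.1‖₊ : ℝ≥0) : ℝ) := by
  have h : ‖φ‖ * ‖ψ‖ ≠ 0 := mul_ne_zero (norm_ne_zero_iff.mpr hφ) (norm_ne_zero_iff.mpr hψ)
  rw [projDist, div_mul_cancel₀ _ h]

/-- Each minor is at most `‖φ̄ − ψ̄‖ · |φ̄| · |ψ̄|`. [folklore] -/
theorem norm_minor_le_projDist_mul {φ ψ : Fin (m + 1) → ℂ} (hφ : φ ≠ 0) (hψ : ψ ≠ 0)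
    (p : SkewIdx m) :
    ‖φ p.1.1 * ψ p.1.2 - φ p.1.2 * ψ p.1.1‖ ≤ projDist φ ψ * (‖φ‖ * ‖ψ‖) := by
  rw [projDist_mul_norm_mul_norm hφ hψ]
  exact norm_minor_le_sup φ ψ p

/-- The first-row minors of `‖ω̄ − β̄‖` at a point with `ω₀ = 1`: `|β_{j+1} − ω_{j+1} β₀|`. [folklore] -/
theorem norm_sub_le_projDist_mul {ω β : Fin (m + 1) → ℂ} (hω0 : ω 0 = 1) (hβ : β ≠ 0) (j : Fin m) :
    ‖β j.succ - ω j.succ * β 0‖ ≤ projDist ω β * (‖ω‖ * ‖β‖) := by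
  have hω : ω ≠ 0 := fun h => by simp [h] at hω0
  have h := norm_minor_le_projDist_mul hω hβ ⟨((0 : Fin (m + 1)), j.succ), Fin.succ_pos j⟩
  simpa [hω0] using h

/-! ### Points at infinity are far from `ω̄` -/

/-- The sup norm of a vector is attained at some coordinate. [folklore] -/
theorem exists_norm_eq_norm_apply (β : Fin (m + 1) → ℂ) : ∃ i, ‖β‖ = ‖β i‖ := by
  obtain ⟨i, -, hi⟩ := Finset.exists_mem_eq_sup (Finset.univ : Finset (Fin (m + 1)))
    Finset.univ_nonempty (fun i => ‖β i‖₊)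
  refine ⟨i, ?_⟩
  rw [Pi.norm_def, hi, coe_nnnorm]

/-- A point `β̄ ≠ 0` at infinity (`β₀ = 0`) is at projective distance `≥ 1/|ω̄|` from any `ω̄` with
`ω₀ = 1`. [folklore] -/
theorem one_div_norm_le_projDist_of_apply_zero {ω β : Fin (m + 1) → ℂ} (hω0 : ω 0 = 1)
    (hβ : β ≠ 0) (hβ0 : β 0 = 0) : 1 / ‖ω‖ ≤ projDist ω β := by
  have hω : ω ≠ 0 := fun h => by simp [h] at hω0
  have hωpos : 0 < ‖ω‖ := norm_pos_iff.mpr hω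
  have hβpos : 0 < ‖β‖ := norm_pos_iff.mpr hβ
  obtain ⟨i, hi⟩ := exists_norm_eq_norm_apply β
  -- the maximal coordinate is not the `0`-th one
  have hi0 : i ≠ 0 := by
    rintro rfl
    rw [hβ0, norm_zero] at hi
    exact hβpos.ne' hi
  obtain ⟨j, rfl⟩ := Fin.exists_succ_eq.mpr hi0
  have h := norm_sub_le_projDist_mul hω0 hβ j
  rw [hβ0, mul_zero, sub_zero, ← hi] at h
  -- `‖β‖ ≤ d ‖ω‖ ‖β‖` gives `1/‖ω‖ ≤ d`
  rw [div_le_iff₀ hωpos]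
  nlinarith

/-- Contrapositive: a zero closer than `1/|ω̄|` to `ω̄` is an affine point (`β₀ ≠ 0`). [folklore] -/
theorem apply_zero_ne_zero_of_projDist_lt {ω β : Fin (m + 1) → ℂ} (hω0 : ω 0 = 1) (hβ : β ≠ 0)
    (h : projDist ω β < 1 / ‖ω‖) : β 0 ≠ 0 := fun hβ0 =>
  (not_le.mpr h) (one_div_norm_le_projDist_of_apply_zero hω0 hβ hβ0)

/-! ### From small projective distance to the polydisc -/

/-- **Projective ⇒ affine.** Let `ω̄ = (1, θ)`, `Θ = |ω̄|`, and `β̄ ≠ 0` with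
`‖ω̄ − β̄‖ · Θ ≤ 1/2`. Then `β₀ ≠ 0`, `|β̄| ≤ 2Θ |β₀|`, and the affine point `z_j = β_{j+1}/β₀`
satisfies `|z_j − θ_j| ≤ 2Θ² ‖ω̄ − β̄‖` for all `j` (cf. Philippon 1986, Lemme 1.16 and p. 43).
[folklore] -/
theorem affine_near_of_projDist_le (θ : Fin m → ℂ) {β : Fin (m + 1) → ℂ} (hβ : β ≠ 0)
    (hd : projDist (Fin.cons 1 θ) β * ‖(Fin.cons 1 θ : Fin (m + 1) → ℂ)‖ ≤ 1 / 2) :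
    β 0 ≠ 0 ∧ ‖β‖ ≤ 2 * ‖(Fin.cons 1 θ : Fin (m + 1) → ℂ)‖ * ‖β 0‖ ∧
      ∀ j : Fin m, ‖β j.succ / β 0 - θ j‖ ≤
        2 * ‖(Fin.cons 1 θ : Fin (m + 1) → ℂ)‖ ^ 2 * projDist (Fin.cons 1 θ) β := by
  set ω : Fin (m + 1) → ℂ := Fin.cons 1 θ with hω
  set Θ : ℝ := ‖ω‖ with hΘ
  set d : ℝ := projDist ω β with hdd
  have hΘ1 : 1 ≤ Θ := one_le_norm_cons_one θ
  have hΘ0 : 0 < Θ := lt_of_lt_of_le one_pos hΘ1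
  have hd0 : 0 ≤ d := projDist_nonneg _ _
  have hβpos : 0 < ‖β‖ := norm_pos_iff.mpr hβ
  -- first-row minors
  have hrow : ∀ j : Fin m, ‖β j.succ - θ j * β 0‖ ≤ d * Θ * ‖β‖ := fun j => by
    have h := norm_sub_le_projDist_mul (cons_one_zero θ) hβ j
    rw [cons_one_succ] at h
    simpa [hdd, hΘ, hω, mul_assoc] using h
  -- `‖β‖ ≤ Θ ‖β 0‖ + d Θ ‖β‖`
  have hnorm : ‖β‖ ≤ Θ * ‖β 0‖ + d * Θ * ‖β‖ := by
    refine (pi_norm_le_iff_of_nonneg (by positivity)).mpr fun i => ?_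
    refine Fin.cases ?_ (fun j => ?_) i
    · have : ‖β 0‖ ≤ Θ * ‖β 0‖ := le_mul_of_one_le_left (norm_nonneg _) hΘ1
      linarith [mul_nonneg (mul_nonneg hd0 hΘ0.le) (norm_nonneg β)]
    · have h1 : ‖β j.succ‖ ≤ ‖θ j * β 0‖ + ‖β j.succ - θ j * β 0‖ := norm_le_insert' _ _
      have h2 : ‖θ j * β 0‖ ≤ Θ * ‖β 0‖ := by
        rw [norm_mul]
        exact mul_le_mul_of_nonneg_right (norm_le_norm_cons_one θ j) (norm_nonneg _)
      linarith [hrow j]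
  have hdΘ : d * Θ ≤ 1 / 2 := hd
  have hβle : ‖β‖ ≤ 2 * Θ * ‖β 0‖ := by nlinarith [norm_nonneg (β 0)]
  have hβ0 : β 0 ≠ 0 := by
    intro h0
    rw [h0, norm_zero, mul_zero] at hβle
    exact (not_le.mpr hβpos) hβle
  have hβ0pos : 0 < ‖β 0‖ := norm_pos_iff.mpr hβ0
  refine ⟨hβ0, hβle, fun j => ?_⟩
  have hq : β j.succ / β 0 - θ j = (β j.succ - θ j * β 0) / β 0 := by
    field_simp
  rw [hq, norm_div, div_le_iff₀ hβ0pos]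
  calc ‖β j.succ - θ j * β 0‖ ≤ d * Θ * ‖β‖ := hrow j
    _ ≤ d * Θ * (2 * Θ * ‖β 0‖) := mul_le_mul_of_nonneg_left hβle (by positivity)
    _ = 2 * Θ ^ 2 * d * ‖β 0‖ := by ring

/-! ### From the polydisc to small projective distance -/

/-- **Affine ⇒ projective.** If `max_j |z_j − θ_j| ≤ r` then `‖(1 : θ) − (1 : z)‖ ≤ 2r`.
[folklore] -/
theorem projDist_cons_one_le (θ z : Fin m → ℂ) {r : ℝ} (hr : 0 ≤ r) (h : ∀ j, ‖z j - θ j‖ ≤ r) :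
    projDist (Fin.cons 1 θ : Fin (m + 1) → ℂ) (Fin.cons 1 z) ≤ 2 * r := by
  set ω : Fin (m + 1) → ℂ := Fin.cons 1 θ with hω
  set y : Fin (m + 1) → ℂ := Fin.cons 1 z with hy
  set Θ : ℝ := ‖ω‖ with hΘ
  have hΘ1 : 1 ≤ Θ := one_le_norm_cons_one θ
  have hy1 : 1 ≤ ‖y‖ := one_le_norm_cons_one z
  have hden : 0 < Θ * ‖y‖ := by positivity
  -- every minor is `≤ 2 Θ r`
  have hminor : ∀ p : SkewIdx m, ‖ω p.1.1 * y p.1.2 - ω p.1.2 * y p.1.1‖ ≤ 2 * Θ * r := by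
    rintro ⟨⟨i, k⟩, hik⟩
    dsimp only at hik ⊢
    -- `k ≠ 0` since `i < k`
    have hk0 : k ≠ 0 := fun h => by subst h; exact (Nat.not_lt_zero _ hik)
    obtain ⟨j, rfl⟩ := Fin.exists_succ_eq.mpr hk0
    refine Fin.cases ?_ (fun i' => ?_) i
    · -- first row: `|z_j − θ_j| ≤ r ≤ 2Θr`
      have e : ω 0 * y j.succ - ω j.succ * y 0 = z j - θ j := by
        simp [hω, hy]
      rw [e]
      nlinarith [h j, hΘ1]
    · -- `|θ_i z_j − θ_j z_i| = |θ_i (z_j − θ_j) − θ_j (z_i − θ_i)| ≤ 2Θr`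
      have e : ω i'.succ * y j.succ - ω j.succ * y i'.succ =
          θ i' * (z j - θ j) - θ j * (z i' - θ i') := by
        simp [hω, hy]; ring
      rw [e]
      have h1 : ‖θ i' * (z j - θ j)‖ ≤ Θ * r := by
        rw [norm_mul]
        exact mul_le_mul (norm_le_norm_cons_one θ i') (h j) (norm_nonneg _) (by positivity)
      have h2 : ‖θ j * (z i' - θ i')‖ ≤ Θ * r := by
        rw [norm_mul]
        exact mul_le_mul (norm_le_norm_cons_one θ j) (h i') (norm_nonneg _) (by positivity)
      calc ‖θ i' * (z j - θ j) - θ j * (z i' - θ i')‖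
          ≤ ‖θ i' * (z j - θ j)‖ + ‖θ j * (z i' - θ i')‖ := norm_sub_le _ _
        _ ≤ 2 * Θ * r := by linarith
  have hnum := sup_minor_le ω y (by positivity) hminor
  rw [projDist, div_le_iff₀ hden]
  calc _ ≤ 2 * Θ * r := hnum
    _ = 2 * r * (Θ * 1) := by ring
    _ ≤ 2 * r * (Θ * ‖y‖) := by
        exact mul_le_mul_of_nonneg_left (mul_le_mul_of_nonneg_left hy1 (by positivity)) (by positivity)

/-! ### `ρ(ω̄)` and zeros -/

/-- If `V(I) ≠ ∅` and `ρ(ω̄) < t` then some zero `β̄` of `I` has `‖ω̄ − β̄‖ < t`. [folklore] -/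
theorem exists_mem_projZeros_projDist_lt {I : Ideal (Rx m)} (hne : (projZeros I).Nonempty)
    {ω : Fin (m + 1) → ℂ} {t : ℝ} (h : rho ω I < t) : ∃ β ∈ projZeros I, projDist ω β < t := by
  obtain ⟨_, ⟨β, hβ, rfl⟩, hlt⟩ := exists_lt_of_csInf_lt (hne.image _) h
  exact ⟨β, hβ, hlt⟩

/-- If every zero `β̄` of `I` has `‖ω̄ − β̄‖ ≥ t` then `ρ(ω̄) ≥ t` (`V(I) ≠ ∅`). [folklore] -/
theorem le_rho_of_forall_le {I : Ideal (Rx m)} (hne : (projZeros I).Nonempty) {ω : Fin (m + 1) → ℂ}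
    {t : ℝ} (h : ∀ β ∈ projZeros I, t ≤ projDist ω β) : t ≤ rho ω I :=
  le_csInf (hne.image _) (by rintro _ ⟨β, hβ, rfl⟩; exact h β hβ)

/-- The zero set of an ideal containing the homogeneous components of its elements (e.g. a
homogeneous ideal) is a cone: `β̄ ∈ V(I)`, `c ≠ 0` ⇒ `c β̄ ∈ V(I)`. [folklore] -/
theorem smul_mem_projZeros {I : Ideal (Rx m)} (hI : ∀ P ∈ I, ∀ k : ℕ, homogeneousComponent k P ∈ I)
    {β : Fin (m + 1) → ℂ} (hβ : β ∈ projZeros I) {c : ℂ} (hc : c ≠ 0) : c • β ∈ projZeros I := by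
  refine ⟨smul_ne_zero hc hβ.1, fun P hP => ?_⟩
  classical
  conv_lhs => rw [← sum_homogeneousComponent P]
  rw [map_sum]
  refine Finset.sum_eq_zero fun k _ => ?_
  rw [aeval_smul_of_isHomogeneous (homogeneousComponent_isHomogeneous k P), hβ.2 _ (hI P hP k),
    mul_zero]

/-- Normalising an affine zero: if `β̄ ∈ V(I)` has `β₀ ≠ 0` then `(1 : β₁/β₀ : … : β_m/β₀) ∈ V(I)`,
for `I` as above. [folklore] -/
theorem cons_one_div_mem_projZeros {I : Ideal (Rx m)}
    (hI : ∀ P ∈ I, ∀ k : ℕ, homogeneousComponent k P ∈ I) {β : Fin (m + 1) → ℂ}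
    (hβ : β ∈ projZeros I) (hβ0 : β 0 ≠ 0) :
    (Fin.cons 1 (fun j : Fin m => β j.succ / β 0) : Fin (m + 1) → ℂ) ∈ projZeros I := by
  have e : (Fin.cons 1 (fun j : Fin m => β j.succ / β 0) : Fin (m + 1) → ℂ) = (β 0)⁻¹ • β := by
    funext i
    refine Fin.cases ?_ (fun j => ?_) i
    · simp [hβ0]
    · simp [div_eq_inv_mul]
  rw [e]
  exact smul_mem_projZeros hI hβ (inv_ne_zero hβ0)

/-- The projective distance is unchanged when the second point is rescaled. [folklore] -/
theorem projDist_smul_right (φ : Fin (m + 1) → ℂ) {β : Fin (m + 1) → ℂ} {c : ℂ} (hc : c ≠ 0) :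
    projDist φ (c • β) = projDist φ β := by
  have hsup : (Finset.univ.sup fun q : SkewIdx m =>
      ‖φ q.1.1 * (c • β) q.1.2 - φ q.1.2 * (c • β) q.1.1‖₊) =
      ‖c‖₊ * Finset.univ.sup fun q : SkewIdx m => ‖φ q.1.1 * β q.1.2 - φ q.1.2 * β q.1.1‖₊ := by
    rw [NNReal.mul_finset_sup]
    refine Finset.sup_congr rfl fun q _ => ?_
    rw [← nnnorm_mul]
    congr 1
    simp only [Pi.smul_apply, smul_eq_mul]
    ring
  rw [projDist, projDist, hsup, norm_smul, NNReal.coe_mul, coe_nnnorm]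
  by_cases hβ : β = 0
  · subst hβ; simp
  have hc' : ‖c‖ ≠ 0 := norm_ne_zero_iff.mpr hc
  field_simp

/-- Hence a zero `β̄` with `β₀ ≠ 0` and its normalisation `(1 : z)` are at the same projective
distance from `ω̄`. [folklore] -/
theorem projDist_cons_one_div_eq (φ : Fin (m + 1) → ℂ) {β : Fin (m + 1) → ℂ} (hβ0 : β 0 ≠ 0) :
    projDist φ (Fin.cons 1 (fun j : Fin m => β j.succ / β 0) : Fin (m + 1) → ℂ) = projDist φ β := by
  have e : (Fin.cons 1 (fun j : Fin m => β j.succ / β 0) : Fin (m + 1) → ℂ) = (β 0)⁻¹ • β := by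
    funext i
    refine Fin.cases ?_ (fun j => ?_) i
    · simp [hβ0]
    · simp [div_eq_inv_mul]
  rw [e, projDist_smul_right φ (inv_ne_zero hβ0)]

end PhilipponMain

end Literature.NumberTheory.Transcendental

end
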